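import Mathlib
import Summits.AtomisticToContinuum.FouriersLaw.Theorems.EmbeddedDrudeMourreDrudeDissolutionGradFluxGlue
import HarnessLib

/-!
# The cube second-difference estimate from a family of cutoffs (the sup-norm route, assembled)
(crux `EmbeddedDrudeMourre.DrudeDissolution`, item stmt-AtomisticToContinuum-12593; `--supports` file for the
registered sub-goal `cube_secondDiff_of_cutoffFamily` of stub B1b″ `stub_excursionSecondDifference` of line
`kinetic-polymer-gas-on-the-time-axis`; closes nothing; lead c13 (process B), 2026-08-17)

WHAT. The abstract end of the sup-norm route. Let `Ω ∈ C³` be triply `2π`-periodic on `ℝ³`, `W ≥ 0`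
continuous with `∫_cell W ≤ M`, and suppose that for every scale `η ∈ (0, η₀]` there is a cutoff `Θ` with
`0 ≤ Θ ≤ 1` such that the cut-off amplitude `G = W·Θ` is `C²`, periodic, vanishes near the critical set
`{D = 0}` (`D = Σ(∂ᵢΩ)²`), has the SUP BOUND `|Σᵢ∂ᵢ((LG)Xᵢ)| ≤ K/η²` (`Xᵢ = ∂ᵢΩ/D`, `LG = Σᵢ∂ᵢ(GXᵢ)`),
and the DISCARDED MASS `∫_cell W(1−Θ) ≤ C_d η⁴`. Then the cube form of B1b″ holds with `α = 1/3`: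
`|∫_cell W·(2φ(Ω) − φ(Ω+δ) − φ(Ω−δ))| ≤ C·δ^{4/3}` for all `δ > 0` and continuous `|φ| ≤ 1`
(`cube_secondDiff_of_cutoffFamily`; `C = 8π³K + 4C_d + 4M/η₀⁴`).

HOW. Split `W = WΘ + W(1−Θ)`; the first piece is `≤ δ²·(2π)³·K/η²` by `cell_secondDiff_le_gradFlux` and
the sup bound, the second `≤ 4C_dη⁴`; take `η = δ^{1/3}` when `δ ≤ η₀³`, and the trivial bound
`4∫W ≤ 4M ≤ 4Mδ^{4/3}/η₀⁴` otherwise.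

WHY (role). What is left of B1b″ after this file is CONCRETE: for the pair resonance `Ω` and the
bracket weight `W` of the line, exhibit the cutoffs (products of `ζ(ρ_k/η²)` over the five squared
distances to the critical curves and corners, `EmbeddedDrudeMourreDrudeDissolutionCutoffs`) and verify the
sup bound (`flux_pointwise_bound` + `supAlgebra_powerCounting` + the structure bounds of `Ω`, `W` + the
gradient floor) and the discarded mass (`W ≲ η²` on the tubes, tube volumes `≲ η²`).
-/

noncomputable section

open Set Filter Function Topology MeasureTheory Real
open scoped Topology

namespace Summit.AtomisticToContinuum.FouriersLaw.Theorems.DrudeDissolution.KineticPolymerGasOnTheTimeAxis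

/-- The cell measure of the whole space is `(2π)³`. [folklore] -/
theorem cell_measure_univ :
    ((volume.restrict (Set.Ioc (-Real.pi) Real.pi)).prod
      ((volume.restrict (Set.Ioc (-Real.pi) Real.pi)).prod (volume.restrict (Set.Ioc (-Real.pi) Real.pi))))
        Set.univ = ENNReal.ofReal ((2 * Real.pi) ^ 3) := by
  have h1 : (volume.restrict (Set.Ioc (-Real.pi) Real.pi)) Set.univ = ENNReal.ofReal (2 * Real.pi) := by
    rw [Measure.restrict_apply_univ, Real.volume_Ioc]; congr 1; ring
  rw [← Set.univ_prod_univ, Measure.prod_prod, ← Set.univ_prod_univ, Measure.prod_prod, h1,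
    ← ENNReal.ofReal_mul (by positivity), ← ENNReal.ofReal_mul (by positivity)]
  congr 1; ring

/-- **The trivial bound**: `|∫_cell W·(2φ(Ω) − φ(Ω+δ) − φ(Ω−δ))| ≤ 4∫_cell W` for `W ≥ 0` continuous
and `|φ| ≤ 1`. [folklore] -/
theorem cell_abs_integral_secondDiff_trivial {Ω W : ℝ × ℝ × ℝ → ℝ} (hW : Continuous W) (hW0 : ∀ p, 0 ≤ W p)
    {φ : ℝ → ℝ} (hφ1 : ∀ x, |φ x| ≤ 1) (δ : ℝ) :
    |∫ p, W p * (2 * φ (Ω p) - φ (Ω p + δ) - φ (Ω p - δ))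
        ∂((volume.restrict (Set.Ioc (-Real.pi) Real.pi)).prod
          ((volume.restrict (Set.Ioc (-Real.pi) Real.pi)).prod (volume.restrict (Set.Ioc (-Real.pi) Real.pi))))| ≤
      4 * ∫ p, W p ∂((volume.restrict (Set.Ioc (-Real.pi) Real.pi)).prod
          ((volume.restrict (Set.Ioc (-Real.pi) Real.pi)).prod (volume.restrict (Set.Ioc (-Real.pi) Real.pi)))) := by
  have hI : Integrable W ((volume.restrict (Set.Ioc (-Real.pi) Real.pi)).prod
      ((volume.restrict (Set.Ioc (-Real.pi) Real.pi)).prod (volume.restrict (Set.Ioc (-Real.pi) Real.pi)))) :=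
    MourreDissolution.levelShift_integrable_cell hW
  rw [← integral_const_mul]
  refine (abs_integral_le_integral_abs).trans (integral_mono_of_nonneg (Eventually.of_forall fun p => abs_nonneg _)
    (hI.const_mul 4) (Eventually.of_forall fun p => ?_))
  show |W p * (2 * φ (Ω p) - φ (Ω p + δ) - φ (Ω p - δ))| ≤ 4 * W p
  rw [abs_mul, abs_of_nonneg (hW0 p), mul_comm]
  refine mul_le_mul_of_nonneg_right ?_ (hW0 p)
  have h1 := hφ1 (Ω p); have h2 := hφ1 (Ω p + δ); have h3 := hφ1 (Ω p - δ)
  calc |2 * φ (Ω p) - φ (Ω p + δ) - φ (Ω p - δ)| ≤ |2 * φ (Ω p) - φ (Ω p + δ)| + |φ (Ω p - δ)| := abs_sub _ _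
    _ ≤ (|2 * φ (Ω p)| + |φ (Ω p + δ)|) + |φ (Ω p - δ)| := by gcongr; exact abs_sub _ _
    _ ≤ (2 * 1 + 1) + 1 := by rw [abs_mul, abs_two]; gcongr
    _ = 4 := by norm_num

/-- **The cube second-difference estimate from a family of cutoffs (registered sub-goal
`cube_secondDiff_of_cutoffFamily` of stub B1b″; all binders explicit).** See the module docstring.
[folklore] -/
theorem cube_secondDiff_of_cutoffFamily :
    ∀ (Ω W D X₁ X₂ X₃ : ℝ × ℝ × ℝ → ℝ) (K Cd η₀ M : ℝ), ContDiff ℝ 3 Ω →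
      (∀ p : ℝ × ℝ × ℝ, Ω (p.1 + 2 * Real.pi, p.2.1, p.2.2) = Ω p) →
      (∀ p : ℝ × ℝ × ℝ, Ω (p.1, p.2.1 + 2 * Real.pi, p.2.2) = Ω p) →
      (∀ p : ℝ × ℝ × ℝ, Ω (p.1, p.2.1, p.2.2 + 2 * Real.pi) = Ω p) →
      Continuous W → (∀ p, 0 ≤ W p) →
      (∀ q, D q = (fderiv ℝ Ω q (1, 0, 0)) ^ 2 + (fderiv ℝ Ω q (0, 1, 0)) ^ 2 + (fderiv ℝ Ω q (0, 0, 1)) ^ 2) →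
      (∀ q, X₁ q = fderiv ℝ Ω q (1, 0, 0) / D q) → (∀ q, X₂ q = fderiv ℝ Ω q (0, 1, 0) / D q) →
      (∀ q, X₃ q = fderiv ℝ Ω q (0, 0, 1) / D q) →
      0 < η₀ → η₀ ≤ 1 → 0 ≤ K → 0 ≤ Cd →
      (∫ p, W p ∂((volume.restrict (Set.Ioc (-Real.pi) Real.pi)).prod
          ((volume.restrict (Set.Ioc (-Real.pi) Real.pi)).prod (volume.restrict (Set.Ioc (-Real.pi) Real.pi)))) ≤ M) →
      (∀ η : ℝ, 0 < η → η ≤ η₀ → ∃ Θ LG : ℝ × ℝ × ℝ → ℝ,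
        (∀ p, 0 ≤ Θ p ∧ Θ p ≤ 1) ∧ ContDiff ℝ 2 (fun p => W p * Θ p) ∧
        (∀ p : ℝ × ℝ × ℝ, W (p.1 + 2 * Real.pi, p.2.1, p.2.2) * Θ (p.1 + 2 * Real.pi, p.2.1, p.2.2) = W p * Θ p) ∧
        (∀ p : ℝ × ℝ × ℝ, W (p.1, p.2.1 + 2 * Real.pi, p.2.2) * Θ (p.1, p.2.1 + 2 * Real.pi, p.2.2) = W p * Θ p) ∧
        (∀ p : ℝ × ℝ × ℝ, W (p.1, p.2.1, p.2.2 + 2 * Real.pi) * Θ (p.1, p.2.1, p.2.2 + 2 * Real.pi) = W p * Θ p) ∧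
        (∀ p, D p = 0 → (fun q => W q * Θ q) =ᶠ[𝓝 p] 0) ∧
        (∀ q, LG q = fderiv ℝ (fun r => W r * Θ r * X₁ r) q (1, 0, 0) +
          fderiv ℝ (fun r => W r * Θ r * X₂ r) q (0, 1, 0) + fderiv ℝ (fun r => W r * Θ r * X₃ r) q (0, 0, 1)) ∧
        (∀ p, |fderiv ℝ (fun q => LG q * X₁ q) p (1, 0, 0) + fderiv ℝ (fun q => LG q * X₂ q) p (0, 1, 0) +
          fderiv ℝ (fun q => LG q * X₃ q) p (0, 0, 1)| ≤ K / η ^ 2) ∧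
        (∫ p, W p * (1 - Θ p) ∂((volume.restrict (Set.Ioc (-Real.pi) Real.pi)).prod
          ((volume.restrict (Set.Ioc (-Real.pi) Real.pi)).prod (volume.restrict (Set.Ioc (-Real.pi) Real.pi)))) ≤
          Cd * η ^ 4)) →
      ∃ C α : ℝ, 0 < α ∧ ∀ δ : ℝ, 0 < δ → ∀ φ : ℝ → ℝ, Continuous φ → (∀ x, |φ x| ≤ 1) →
        |∫ p, W p * (2 * φ (Ω p) - φ (Ω p + δ) - φ (Ω p - δ))
            ∂((volume.restrict (Set.Ioc (-Real.pi) Real.pi)).prod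
              ((volume.restrict (Set.Ioc (-Real.pi) Real.pi)).prod (volume.restrict (Set.Ioc (-Real.pi) Real.pi))))| ≤
          C * δ ^ (1 + α) := by
  intro Ω W D X₁ X₂ X₃ K Cd η₀ M hΩ hΩ₁ hΩ₂ hΩ₃ hW hW0 hD hX₁ hX₂ hX₃ hη₀ hη₀1 hK hCd hM hfam
  set μc : Measure (ℝ × ℝ × ℝ) := (volume.restrict (Set.Ioc (-Real.pi) Real.pi)).prod
    ((volume.restrict (Set.Ioc (-Real.pi) Real.pi)).prod (volume.restrict (Set.Ioc (-Real.pi) Real.pi))) with hμc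
  have hΩc : Continuous Ω := hΩ.continuous
  have hWI : Integrable W μc := MourreDissolution.levelShift_integrable_cell hW
  have hM0 : 0 ≤ M := le_trans (integral_nonneg fun p => hW0 p) hM
  haveI : IsFiniteMeasure μc := by
    refine ⟨?_⟩
    rw [hμc, cell_measure_univ]; exact ENNReal.ofReal_lt_top
  -- the constant
  refine ⟨8 * Real.pi ^ 3 * K + 4 * Cd + 4 * M / η₀ ^ 4, 1 / 3, by norm_num, fun δ hδ φ hφ hφ1 => ?_⟩
  have h43 : (1 : ℝ) + 1 / 3 = 4 / 3 := by norm_num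
  rw [h43]
  have hδ43 : 0 < δ ^ ((4 : ℝ) / 3) := Real.rpow_pos_of_pos hδ _
  by_cases hsmall : δ ≤ η₀ ^ 3
  · -- η = δ^{1/3} ∈ (0, η₀]
    set η := δ ^ ((1 : ℝ) / 3) with hηdef
    have hη : 0 < η := Real.rpow_pos_of_pos hδ _
    have hη3 : η ^ 3 = δ := by
      rw [hηdef, ← Real.rpow_natCast, ← Real.rpow_mul hδ.le]; norm_num
    have hηle : η ≤ η₀ := by
      by_contra hcon
      push Not at hcon
      have : η₀ ^ 3 < η ^ 3 := by gcongr
      rw [hη3] at this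
      linarith
    have hη2 : η ^ 2 = δ ^ ((2 : ℝ) / 3) := by
      rw [hηdef, ← Real.rpow_natCast, ← Real.rpow_mul hδ.le]; norm_num
    have hη4 : η ^ 4 = δ ^ ((4 : ℝ) / 3) := by
      rw [hηdef, ← Real.rpow_natCast, ← Real.rpow_mul hδ.le]; norm_num
    obtain ⟨Θ, LG, hΘ01, hGC, hGp₁, hGp₂, hGp₃, hGvan, hLG, hsup, hdisc⟩ := hfam η hη hηle
    -- split `W = WΘ + W(1-Θ)`
    set H : ℝ × ℝ × ℝ → ℝ := fun p => 2 * φ (Ω p) - φ (Ω p + δ) - φ (Ω p - δ) with hHdef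
    have hHc : Continuous H := by
      have := hφ; simp only [hHdef]; fun_prop
    have hH4 : ∀ p, |H p| ≤ 4 := fun p => by
      have h1 := hφ1 (Ω p); have h2 := hφ1 (Ω p + δ); have h3 := hφ1 (Ω p - δ)
      simp only [hHdef]
      calc |2 * φ (Ω p) - φ (Ω p + δ) - φ (Ω p - δ)| ≤ |2 * φ (Ω p) - φ (Ω p + δ)| + |φ (Ω p - δ)| := abs_sub _ _
        _ ≤ (|2 * φ (Ω p)| + |φ (Ω p + δ)|) + |φ (Ω p - δ)| := by gcongr; exact abs_sub _ _
        _ ≤ (2 * 1 + 1) + 1 := by rw [abs_mul, abs_two]; gcongr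
        _ = 4 := by norm_num
    have hΘc : Continuous fun p => W p * Θ p := hGC.continuous
    have hI1 : Integrable (fun p => W p * Θ p * H p) μc :=
      MourreDissolution.levelShift_integrable_cell (hΘc.mul hHc)
    have hI2 : Integrable (fun p => W p * (1 - Θ p) * H p) μc := by
      have : (fun p => W p * (1 - Θ p) * H p) = fun p => W p * H p - W p * Θ p * H p := funext fun p => by ring
      rw [this]
      exact (MourreDissolution.levelShift_integrable_cell (hW.mul hHc)).sub hI1
    have hsplit : ∫ p, W p * H p ∂μc = (∫ p, W p * Θ p * H p ∂μc) + ∫ p, W p * (1 - Θ p) * H p ∂μc := by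
      rw [← integral_add hI1 hI2]
      refine integral_congr_ae (Eventually.of_forall fun p => ?_)
      simp only
      ring
    -- flux piece
    have hflux : |∫ p, W p * Θ p * H p ∂μc| ≤ δ ^ 2 * ((2 * Real.pi) ^ 3 * (K / η ^ 2)) := by
      have hE := cell_secondDiff_le_gradFlux Ω (fun p => W p * Θ p) D X₁ X₂ X₃ LG φ δ hΩ hΩ₁ hΩ₂ hΩ₃ hGC
        hGp₁ hGp₂ hGp₃ hD hX₁ hX₂ hX₃ hLG hGvan hφ hφ1 hδ.le
      refine hE.trans (mul_le_mul_of_nonneg_left ?_ (sq_nonneg _))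
      -- the integrand is measurable and bounded by `K/η²`
      set Q : ℝ × ℝ × ℝ → ℝ := fun p => fderiv ℝ (fun q => LG q * X₁ q) p (1, 0, 0) +
        fderiv ℝ (fun q => LG q * X₂ q) p (0, 1, 0) + fderiv ℝ (fun q => LG q * X₃ q) p (0, 0, 1) with hQ
      have hQm : AEStronglyMeasurable (fun p => |Q p|) μc := by
        refine (Measurable.aestronglyMeasurable ?_)
        refine Measurable.abs ?_
        simp only [hQ]
        exact ((measurable_fderiv_apply_const ℝ _ _).add (measurable_fderiv_apply_const ℝ _ _)).add
          (measurable_fderiv_apply_const ℝ _ _)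
      have hQi : Integrable (fun p => |Q p|) μc :=
        Integrable.mono' (integrable_const (K / η ^ 2)) hQm
          (Eventually.of_forall fun p => by rw [Real.norm_eq_abs, abs_abs]; exact hsup p)
      calc ∫ p, |Q p| ∂μc ≤ ∫ _p, K / η ^ 2 ∂μc :=
            integral_mono hQi (integrable_const _) fun p => hsup p
        _ = (2 * Real.pi) ^ 3 * (K / η ^ 2) := by
            rw [integral_const, smul_eq_mul, Measure.real, hμc, cell_measure_univ,
              ENNReal.toReal_ofReal (by positivity)]
    -- discarded piece
    have hdis : |∫ p, W p * (1 - Θ p) * H p ∂μc| ≤ 4 * (Cd * η ^ 4) := by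
      have hI3 : Integrable (fun p => W p * (1 - Θ p)) μc := by
        have : (fun p => W p * (1 - Θ p)) = fun p => W p - W p * Θ p := funext fun p => by ring
        rw [this]; exact hWI.sub (MourreDissolution.levelShift_integrable_cell hΘc)
      calc |∫ p, W p * (1 - Θ p) * H p ∂μc| ≤ ∫ p, |W p * (1 - Θ p) * H p| ∂μc := abs_integral_le_integral_abs
        _ ≤ ∫ p, 4 * (W p * (1 - Θ p)) ∂μc := by
            refine integral_mono_of_nonneg (Eventually.of_forall fun p => abs_nonneg _) (hI3.const_mul 4)
              (Eventually.of_forall fun p => ?_)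
            show |W p * (1 - Θ p) * H p| ≤ 4 * (W p * (1 - Θ p))
            have hnn : 0 ≤ W p * (1 - Θ p) := mul_nonneg (hW0 p) (by linarith [(hΘ01 p).2])
            rw [abs_mul, abs_of_nonneg hnn, mul_comm]
            exact mul_le_mul_of_nonneg_right (hH4 p) hnn
        _ = 4 * ∫ p, W p * (1 - Θ p) ∂μc := integral_const_mul _ _
        _ ≤ 4 * (Cd * η ^ 4) := by gcongr
    -- combine
    have htot : |∫ p, W p * H p ∂μc| ≤ δ ^ 2 * ((2 * Real.pi) ^ 3 * (K / η ^ 2)) + 4 * (Cd * η ^ 4) := by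
      rw [hsplit]; exact (abs_add_le _ _).trans (add_le_add hflux hdis)
    refine htot.trans ?_
    -- `δ²/η² = δ^{4/3}`, `η⁴ = δ^{4/3}`
    have hδ2 : δ ^ 2 / η ^ 2 = δ ^ ((4 : ℝ) / 3) := by
      rw [hη2, show (δ ^ 2 : ℝ) = δ ^ (2 : ℝ) by rw [← Real.rpow_natCast]; norm_num,
        ← Real.rpow_sub hδ]; norm_num
    have e1 : δ ^ 2 * ((2 * Real.pi) ^ 3 * (K / η ^ 2)) = 8 * Real.pi ^ 3 * K * δ ^ ((4 : ℝ) / 3) := by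
      rw [← hδ2]; field_simp; ring
    rw [e1, hη4]
    have hMt : 0 ≤ 4 * M / η₀ ^ 4 * δ ^ ((4 : ℝ) / 3) := by positivity
    nlinarith [hMt, hδ43, hK, hCd, Real.pi_pos]
  · -- large δ: trivial bound
    push Not at hsmall
    have htriv := cell_abs_integral_secondDiff_trivial (Ω := Ω) hW hW0 hφ1 δ
    refine htriv.trans ?_
    have h1 : 4 * ∫ p, W p ∂μc ≤ 4 * M := by linarith
    -- `η₀⁴ = (η₀³)^{4/3} ≤ δ^{4/3}`
    have hδη : η₀ ^ 4 ≤ δ ^ ((4 : ℝ) / 3) := by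
      have e : η₀ ^ 4 = (η₀ ^ 3) ^ ((4 : ℝ) / 3) := by
        rw [show (η₀ ^ 3 : ℝ) = η₀ ^ (3 : ℝ) by rw [← Real.rpow_natCast]; norm_num,
          ← Real.rpow_mul hη₀.le, show ((3 : ℝ) * (4 / 3)) = ((4 : ℕ) : ℝ) by norm_num, Real.rpow_natCast]
      rw [e]
      exact Real.rpow_le_rpow (pow_nonneg hη₀.le 3) hsmall.le (by norm_num)
    have h2 : 4 * M ≤ 4 * M / η₀ ^ 4 * δ ^ ((4 : ℝ) / 3) := by
      rw [div_mul_eq_mul_div, le_div_iff₀ (pow_pos hη₀ 4)]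
      calc 4 * M * η₀ ^ 4 ≤ 4 * M * δ ^ ((4 : ℝ) / 3) := by gcongr
        _ = 4 * M * δ ^ ((4 : ℝ) / 3) := rfl
    have h3 : 4 * M / η₀ ^ 4 * δ ^ ((4 : ℝ) / 3) ≤ (8 * Real.pi ^ 3 * K + 4 * Cd + 4 * M / η₀ ^ 4) * δ ^ ((4 : ℝ) / 3) := by
      gcongr
      nlinarith [hK, hCd, Real.pi_pos, pow_pos Real.pi_pos 3]
    linarith

end Summit.AtomisticToContinuum.FouriersLaw.Theorems.DrudeDissolution.KineticPolymerGasOnTheTimeAxis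

end
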